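import Literature.Barriers.RiemannHypothesis.EpsteinZetaRealZerosNearOne
import Mathlib.Analysis.SpecialFunctions.Log.Monotone
import HarnessLib

/-!
# The Bateman–Grosswald zero located: `ζ_Q` has a real zero `β` with `1/(5k) < 1 − β < 4/k` (`k ≥ 50`)

Barrier audit (D-0021, generation 6, 2026-08-17) of `Literature.Barriers.RiemannHypothesis.EpsteinZetaRealZeros`
— companion of `EpsteinZetaRealZerosNearOne.lean` (which proves `Re ζ_Q(σ) < 0` on `[1 − 1/(5k), 1)`
for `k ≥ 1`). Everything in this file is PROVED (theorems only; no definitions, no named facts).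

Bateman–Grosswald (Acta Arith. 9 (1964), Theorem 3 (10) and p. 367) prove that `ζ_Q` "vanishes in
`(½, 1)` if `k ≥ 7.0556`" (`BatemanGrosswald1964_realZero_holds`) and Stark (Mathematika 14 (1967),
Theorem 1, §4) that for large `k` this real pair is the only violation of the Riemann hypothesis with
`|t| ≤ 2k`; neither locates the zero. Here it is located at the scale `1 − β ≍ 1/k`, i.e. — for the
principal form, `k = √|d|/2` — at the position `≍ |d|^{−½}` of an exceptional zero of an imaginary
quadratic field with bounded class number:

* `re_thetaΛ_pos_of_le_im` — **`Re Λ_z(1 − 4/y) > 0` for `y = Im z ≥ 50`** (`Λ_z` the completed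
  Epstein zeta function of `ℤz + ℤ`): with `δ = 4/y`, the constant term gives
  `2y^{1−δ}Λ(2 − 2δ) ≥ (3/5)y` (`Λ(u) ≥ −1/u + 1/(u − 1) ≥ 9/20` on `[1.84, 2)`, `y^{1−δ} ≥ (2/3)y`
  because `y^{4/y} ≤ 3/2` for `y ≥ 50`), `2y^δΛ(2δ) ≥ −(3/8)y − 25/7` (`Λ(u) ≥ −1/u − 1/(1 − u)`,
  `Λ₀ ≥ 0`), and `|E_z| ≤ 48√y e^{−1.4πy} ≤ 2`; total `≥ (9/40)y − 39/7 > 0`.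
* `exists_realZero_located` — **for `k ≥ 50` every analytic continuation of `ζ_Q` has a real zero
  `β` with `1 − 4/k < β < 1 − 1/(5k)`** (intermediate value theorem between the two signs; the
  transfer `Z = c(σ)Λ_{z'}`, `c > 0`, `Im z' = k`, as for Bateman–Grosswald (10)). The true
  position is `1 − β = (3/π + o(1))/k`.

For the barrier this pins the obstruction: the class-isolated sign argument for
`ζ(s)L(s, χ_{−d}) = ½∑_Q Z_Q(s)` reaches `[1 − 2/(5√d), 1)`
(`Literature.Barriers.RiemannHypothesis.LFunction_re_pos_of_odd_quadratic`) and CANNOT reach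
`1 − 8/√d` (`d ≥ 10⁴`), where the principal class already vanishes.

## References

* [BatemanGrosswald1964] P. T. Bateman, E. Grosswald, *On Epstein's zeta function*, Acta Arith. 9
  (1964), 365–373, Theorem 1 (3)–(5), Theorem 3 (10) and p. 367.
* [Stark1967EpsteinZeros] H. M. Stark, *On the zeros of Epstein's zeta function*, Mathematika 14
  (1967), 47–55, Theorem 1 and §4 (re-read; the real pair is only placed "between `0` and `1`").
-/

noncomputable section

open Complex Filter Topology MeasureTheory Set HurwitzZeta
open scoped UpperHalfPlane

namespace Literature.Barriers.RiemannHypothesis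

open Literature.NumberTheory.Automorphic
open Literature.NumberTheory.LFunctions.RealZeros

/-! ## Lower bounds for the completed Riemann zeta function on the real axis -/

/-- `Re Λ₀(u) ≥ 0` for real `u` (the Mellin kernel is non-negative). [folklore] -/
theorem re_completedRiemannZeta₀_nonneg (u : ℝ) : 0 ≤ (completedRiemannZeta₀ u).re := by
  rw [re_completedRiemannZeta₀_ofReal]
  refine div_nonneg (setIntegral_nonneg measurableSet_Ioi fun t ht => ?_) (by norm_num)
  exact mul_nonneg (Real.rpow_nonneg (le_of_lt ht) _) (kernel_nonneg t)

/-- `Re Λ(u) ≥ −1/u + 1/(u − 1)` for real `u > 1`. [folklore] -/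
theorem re_completedRiemannZeta_ge_of_one_lt {u : ℝ} (_h1 : 1 < u) :
    -(1 / u) + 1 / (u - 1) ≤ (completedRiemannZeta u).re := by
  rw [completedRiemannZeta_eq]
  have hE := re_completedRiemannZeta₀_nonneg u
  have hσ : (1 / (u : ℂ)).re = 1 / u := by
    rw [← Complex.ofReal_one, ← Complex.ofReal_div, Complex.ofReal_re]
  have hσ' : (1 / (1 - (u : ℂ))).re = 1 / (1 - u) := by
    rw [← Complex.ofReal_one, ← Complex.ofReal_sub, ← Complex.ofReal_div, Complex.ofReal_re]
  simp only [sub_re, hσ, hσ']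
  have hu : 1 / (1 - u) = -(1 / (u - 1)) := by
    rw [← div_neg, neg_sub]
  rw [hu]
  linarith

/-- `Re Λ(u) ≥ −1/u − 1/(1 − u)` for real `0 < u < 1`. [folklore] -/
theorem re_completedRiemannZeta_ge_of_lt_one {u : ℝ} (_h0 : 0 < u) (_h1 : u < 1) :
    -(1 / u) - 1 / (1 - u) ≤ (completedRiemannZeta u).re := by
  rw [completedRiemannZeta_eq]
  have hE := re_completedRiemannZeta₀_nonneg u
  have hσ : (1 / (u : ℂ)).re = 1 / u := by
    rw [← Complex.ofReal_one, ← Complex.ofReal_div, Complex.ofReal_re]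
  have hσ' : (1 / (1 - (u : ℂ))).re = 1 / (1 - u) := by
    rw [← Complex.ofReal_one, ← Complex.ofReal_sub, ← Complex.ofReal_div, Complex.ofReal_re]
  simp only [sub_re, hσ, hσ']
  linarith

/-! ## Numerics -/

/-- `log 50 < 4` (`e⁴ > 54`). [folklore] -/
theorem log_fifty_lt_four : Real.log 50 < 4 := by
  have he := Real.exp_one_gt_d9
  have h2 : (7.3 : ℝ) < Real.exp 2 := by
    rw [show (2 : ℝ) = 1 + 1 by norm_num, Real.exp_add]
    nlinarith
  have h4 : (50 : ℝ) < Real.exp 4 := by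
    rw [show (4 : ℝ) = 2 + 2 by norm_num, Real.exp_add]
    nlinarith [Real.exp_pos 2]
  rw [Real.log_lt_iff_lt_exp (by norm_num)]
  exact h4

/-- **`y^{4/y} ≤ 3/2` for `y ≥ 50`** (`log y / y ≤ log 50 / 50 < 0.08`, `e^{0.32} ≤ 1/0.68`). [folklore] -/
theorem rpow_four_div_le {y : ℝ} (hy : 50 ≤ y) : y ^ (4 / y) ≤ 3 / 2 := by
  have hy0 : 0 < y := by linarith
  have he1 : Real.exp 1 ≤ 50 := by
    have := Real.exp_one_lt_d9; linarith
  have hmono := Real.log_div_self_antitoneOn (show (50 : ℝ) ∈ Set.Ici (Real.exp 1) from he1)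
    (show y ∈ Set.Ici (Real.exp 1) from le_trans he1 hy) hy
  simp only at hmono
  have hlog : Real.log y / y ≤ 0.08 := by
    have h50 : Real.log 50 / 50 < 0.08 := by
      rw [div_lt_iff₀ (by norm_num)]
      linarith [log_fifty_lt_four]
    linarith
  rw [Real.rpow_def_of_pos hy0]
  have hexp : Real.log y * (4 / y) ≤ 0.32 := by
    rw [show Real.log y * (4 / y) = 4 * (Real.log y / y) by ring]
    linarith
  calc Real.exp (Real.log y * (4 / y)) ≤ Real.exp 0.32 := Real.exp_le_exp.2 hexp
    _ ≤ 3 / 2 := by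
        have h := Real.add_one_le_exp (-0.32)
        have hpos : 0 < Real.exp (-0.32) := Real.exp_pos _
        rw [show (0.32 : ℝ) = -(-0.32) by ring, Real.exp_neg]
        rw [inv_le_comm₀ hpos (by norm_num)]
        linarith

/-! ## `y ≥ 50`: `Λ_z(1 − 4/y) > 0` -/

/-- **The completed Epstein zeta function is still POSITIVE at `σ = 1 − 4/y`** (`y = Im z ≥ 50`):
with `δ = 4/y`, `Λ_z(1 − δ) = 2y^{1−δ}Λ(2 − 2δ) + 2y^δΛ(2δ) + E_z ≥ (3/5)y − (3/8)y − 25/7 − 2 > 0`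
(`Λ(2−2δ) ≥ 9/20`, `y^{1−δ} ≥ (2/3)y`, `Λ(2δ) ≥ −y/8 − 25/21`, `y^δ ≤ 3/2`, `|E_z| ≤ 2`). [folklore] -/
theorem re_thetaΛ_pos_of_le_im (z : ℍ) (hy : 50 ≤ z.im) :
    0 < ((thetaFEPair z).Λ ((1 - 4 / z.im : ℝ) : ℂ)).re := by
  set y := z.im with hydef
  have hy0 : 0 < y := by linarith
  have hy1 : 1 ≤ y := by linarith
  set δ : ℝ := 4 / y with hδ
  have hδ0 : 0 < δ := by positivity
  have hδ1 : δ ≤ 0.08 := by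
    rw [hδ, div_le_iff₀ hy0]; linarith
  set σ : ℝ := 1 - 4 / y with hσdef
  have hσδ : σ = 1 - δ := by rw [hσdef, hδ]
  have hσ0 : (0 : ℝ) < σ := by rw [hσδ]; linarith
  have hσ1 : σ < 1 := by rw [hσδ]; linarith
  -- the decomposition at `s = σ`
  have h0 : (σ : ℂ) ≠ 0 := by exact_mod_cast hσ0.ne'
  have h1 : (σ : ℂ) ≠ 1 := by exact_mod_cast hσ1.ne
  have hh : (σ : ℂ) ≠ 1 / 2 := by
    intro h
    have := congrArg Complex.re h
    simp at this
    linarith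
  have hdec := Λ_eq_constantTerm_add_besselPart z hy1 h0 h1 hh
  have eA : (2 * ((y : ℝ) : ℂ) ^ (σ : ℂ) * completedRiemannZeta (2 * (σ : ℂ))).re =
      2 * y ^ σ * (completedRiemannZeta ((2 * σ : ℝ) : ℂ)).re := by
    rw [show (2 : ℂ) * (σ : ℂ) = ((2 * σ : ℝ) : ℂ) by push_cast; ring, ← Complex.ofReal_cpow hy0.le,
      show (2 : ℂ) * ((y ^ σ : ℝ) : ℂ) = ((2 * y ^ σ : ℝ) : ℂ) by push_cast; ring,
      Complex.re_ofReal_mul]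
  have eB : (2 * ((y : ℝ) : ℂ) ^ (1 - (σ : ℂ)) * completedRiemannZeta (2 - 2 * (σ : ℂ))).re =
      2 * y ^ (1 - σ) * (completedRiemannZeta ((2 - 2 * σ : ℝ) : ℂ)).re := by
    rw [show (2 : ℂ) - 2 * (σ : ℂ) = ((2 - 2 * σ : ℝ) : ℂ) by push_cast; ring,
      show (1 : ℂ) - (σ : ℂ) = ((1 - σ : ℝ) : ℂ) by push_cast; ring, ← Complex.ofReal_cpow hy0.le,
      show (2 : ℂ) * ((y ^ (1 - σ) : ℝ) : ℂ) = ((2 * y ^ (1 - σ) : ℝ) : ℂ) by push_cast; ring,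
      Complex.re_ofReal_mul]
  -- `y^δ ≤ 3/2`, `y^{1−δ} ≥ (2/3) y`
  have hyd : y ^ δ ≤ 3 / 2 := rpow_four_div_le hy
  have hyd0 : 0 < y ^ δ := Real.rpow_pos_of_pos hy0 δ
  have hyσ : 2 / 3 * y ≤ y ^ σ := by
    rw [hσδ, Real.rpow_sub hy0, Real.rpow_one, le_div_iff₀ hyd0]
    nlinarith
  -- term A ≥ (3/5) y
  have hA : 3 / 5 * y ≤ 2 * y ^ σ * (completedRiemannZeta ((2 * σ : ℝ) : ℂ)).re := by
    have hL := re_completedRiemannZeta_ge_of_one_lt (u := 2 * σ) (by rw [hσδ]; linarith)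
    have hL1 : 9 / 20 ≤ (completedRiemannZeta ((2 * σ : ℝ) : ℂ)).re := by
      have e1 : 1 / (2 * σ) ≤ 25 / 46 := by
        rw [div_le_div_iff₀ (by positivity) (by norm_num)]; rw [hσδ]; linarith
      have e2 : 1 ≤ 1 / (2 * σ - 1) := by
        rw [le_div_iff₀ (by linarith)]; linarith
      linarith
    calc 3 / 5 * y = 2 * (2 / 3 * y) * (9 / 20) := by ring
      _ ≤ 2 * y ^ σ * (9 / 20) := by nlinarith
      _ ≤ 2 * y ^ σ * (completedRiemannZeta ((2 * σ : ℝ) : ℂ)).re :=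
          mul_le_mul_of_nonneg_left hL1 (by positivity)
  -- term B ≥ −(3/8) y − 25/7
  have hB : -(3 / 8 * y) - 25 / 7 ≤ 2 * y ^ (1 - σ) * (completedRiemannZeta ((2 - 2 * σ : ℝ) : ℂ)).re := by
    have h2δ : 2 - 2 * σ = 2 * δ := by rw [hσδ]; ring
    have h1σ : 1 - σ = δ := by rw [hσδ]; ring
    rw [h2δ, h1σ]
    have hL := re_completedRiemannZeta_ge_of_lt_one (u := 2 * δ) (by positivity) (by linarith)
    have hU := re_completedRiemannZeta_lt_of_lt_one (u := 2 * δ) (by positivity) (by linarith)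
    -- `Λ(2δ) < 0`
    have hneg : (completedRiemannZeta ((2 * δ : ℝ) : ℂ)).re < 0 := by
      have e2 : 1 < 1 / (1 - 2 * δ) := by rw [lt_div_iff₀ (by linarith)]; linarith
      have e3 : 0 < 1 / (2 * δ) := by positivity
      linarith
    -- `Λ(2δ) ≥ −y/8 − 25/21`
    have hlow : -(y / 8) - 25 / 21 ≤ (completedRiemannZeta ((2 * δ : ℝ) : ℂ)).re := by
      have e1 : 1 / (2 * δ) = y / 8 := by rw [hδ]; field_simp; ring
      have e2 : 1 / (1 - 2 * δ) ≤ 25 / 21 := by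
        rw [div_le_div_iff₀ (by linarith) (by norm_num)]; linarith
      linarith
    -- `y^δ Λ(2δ) ≥ (3/2) Λ(2δ)` since `Λ(2δ) < 0`, `y^δ ≤ 3/2`
    have hmul : 3 / 2 * (completedRiemannZeta ((2 * δ : ℝ) : ℂ)).re ≤
        y ^ δ * (completedRiemannZeta ((2 * δ : ℝ) : ℂ)).re := by nlinarith
    nlinarith
  -- term C ≥ −2
  have hC : -2 ≤ (epsteinBesselPart z σ).re := by
    have hn := norm_epsteinBesselPart_le z hy1 (s := (σ : ℂ)) (by simp; linarith) (by simp; linarith)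
    have hre : -‖epsteinBesselPart z σ‖ ≤ (epsteinBesselPart z σ).re :=
      (abs_le.1 (Complex.abs_re_le_norm _)).1
    -- `e^{−1.4πy} ≤ e^{−4y} ≤ 1/(4y + 1)`
    have hexp : Real.exp (-(7 / 5) * Real.pi * y) ≤ 1 / (4 * y + 1) := by
      have h1 : Real.exp (-(7 / 5) * Real.pi * y) ≤ Real.exp (-(4 * y)) :=
        Real.exp_le_exp.2 (by nlinarith [Real.pi_gt_three])
      have h2 := Real.add_one_le_exp (4 * y)
      have h3 : Real.exp (-(4 * y)) ≤ 1 / (4 * y + 1) := by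
        rw [Real.exp_neg, inv_eq_one_div]
        exact one_div_le_one_div_of_le (by positivity) h2
      exact h1.trans h3
    have hs7 : 7 ≤ Real.sqrt y := (Real.le_sqrt' (by norm_num)).2 (by linarith)
    have hsq : Real.sqrt y ^ 2 = y := Real.sq_sqrt hy0.le
    have hbound : 48 * Real.sqrt y * Real.exp (-(7 / 5) * Real.pi * y) ≤ 2 := by
      calc 48 * Real.sqrt y * Real.exp (-(7 / 5) * Real.pi * y)
          ≤ 48 * Real.sqrt y * (1 / (4 * y + 1)) := mul_le_mul_of_nonneg_left hexp (by positivity)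
        _ = 48 * Real.sqrt y / (4 * y + 1) := by ring
        _ ≤ 2 := by
            rw [div_le_iff₀ (by positivity)]
            nlinarith
    linarith
  rw [hdec, Complex.add_re, Complex.add_re, eA, eB]
  linarith

/-! ## The Bateman–Grosswald zero located -/

variable {a b c : ℝ}

/-- **The real zero of `ζ_Q` located: `1 − 4/k < β < 1 − 1/(5k)` for `k ≥ 50`.** For a positive
definite real form `Q` with `k = √|d|/(2a) ≥ 50`, every analytic continuation `Z` of `ζ_Q` has a real
zero `β` with `1/(5k) < 1 − β < 4/k` (`Λ_{z'}(1 − 4/k) > 0 > Λ_{z'}(1 − 1/(5k))`, `Im z' = k`, and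
the intermediate value theorem; `Z = c(σ)Λ_{z'}` on `(0, 1)` with `c > 0`). For the principal form
(`k = √|d|/2`, `|d| ≥ 10⁴`): a real zero with `0.4/√|d| < 1 − β < 8/√|d|` — the position of an
exceptional zero of a field with bounded class number. Bateman–Grosswald prove existence in `(½, 1)`
for `k > 7.0556`; the location is not printed. [cite: BatemanGrosswald1964, Theorem 3 (10) and p. 367] -/
theorem exists_realZero_located (h : IsPosDefForm a b c) (hk : 50 ≤ starkK a b c)
    {Z : ℂ → ℂ} (hZ : IsEpsteinContinuation a b c Z) :
    ∃ β : ℝ, 1 - 4 / starkK a b c < β ∧ β < 1 - 1 / (5 * starkK a b c) ∧ Z β = 0 := by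
  obtain ⟨z, hre, him, hk'⟩ := exists_zQ' h
  have hZ' : IsEpsteinContinuation c b a Z := (isEpsteinContinuation_swap_iff a b c Z).2 hZ
  rw [← hk'] at hk ⊢
  set y := z.im with hydef
  have hy0 : 0 < y := by linarith
  set σ₁ : ℝ := 1 - 4 / y with hσ₁
  set σ₂ : ℝ := 1 - 1 / (5 * y) with hσ₂
  have h4 : 4 / y ≤ 0.08 := by rw [div_le_iff₀ hy0]; linarith
  have h5 : 1 / (5 * y) ≤ 1 / 250 := by
    rw [div_le_div_iff₀ (by positivity) (by norm_num)]; linarith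
  have h45 : 1 / (5 * y) < 4 / y := by
    rw [div_lt_div_iff₀ (by positivity) hy0]; linarith
  have h12 : σ₁ < σ₂ := by rw [hσ₁, hσ₂]; linarith
  have hσ₁0 : 1 / 2 ≤ σ₁ := by rw [hσ₁]; linarith
  have hσ₂1 : σ₂ < 1 := by rw [hσ₂]; linarith [show 0 < 1 / (5 * y) from by positivity]
  have hpos : 0 < ((thetaFEPair z).Λ (σ₁ : ℂ)).re := re_thetaΛ_pos_of_le_im z hk
  have hneg : ((thetaFEPair z).Λ (σ₂ : ℂ)).re < 0 :=
    re_thetaΛ_neg_of_one_le_im z (by linarith) (le_of_eq hσ₂.symm) hσ₂1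
  have hcont : ContinuousOn (fun σ : ℝ => ((thetaFEPair z).Λ σ).re) (Icc σ₁ σ₂) :=
    (continuousOn_re_Λ z hσ₂1).mono (Icc_subset_Icc hσ₁0 le_rfl)
  have hivt := intermediate_value_Icc' h12.le hcont
  have h0mem : (0 : ℝ) ∈ Icc ((thetaFEPair z).Λ (σ₂ : ℂ)).re ((thetaFEPair z).Λ (σ₁ : ℂ)).re :=
    ⟨hneg.le, hpos.le⟩
  obtain ⟨β, hβ, hβ0⟩ := hivt h0mem
  have hβ0 : ((thetaFEPair z).Λ β).re = 0 := hβ0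
  have hβ1 : β ≠ σ₁ := by
    rintro rfl; rw [hβ0] at hpos; exact lt_irrefl _ hpos
  have hβ2 : β ≠ σ₂ := by
    rintro rfl; rw [hβ0] at hneg; exact lt_irrefl _ hneg
  have hlt1 : σ₁ < β := lt_of_le_of_ne hβ.1 (Ne.symm hβ1)
  have hlt2 : β < σ₂ := lt_of_le_of_ne hβ.2 hβ2
  refine ⟨β, hlt1, hlt2, ?_⟩
  have hβpos : 0 < β := by linarith
  have hβlt1 : β < 1 := by linarith
  rw [continuation_ofReal_eq h.swap z hre him hZ' hβpos hβlt1, Λ_ofReal_eq_re, hβ0,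
    Complex.ofReal_zero, mul_zero]

end Literature.Barriers.RiemannHypothesis

end
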